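import Summits.QuantumFields.YangMills.Theorems.FemtoTransferGapGroundState
import Summits.QuantumFields.YangMills.Theorems.FemtoCutoffLadderThinningAveraged
import Summits.QuantumFields.YangMills.Theorems.LuscherReductionRunningReductionKTPhysSpace
import Summits.QuantumFields.YangMills.Theorems.LuscherReductionDressedRitzPolyakovLiftStaticsPrep
import Literature.MathematicalPhysics.QuantumFieldTheory.LatticeGaugeProofs
import HarnessLib

/-!
# FlatTubeReduction / `PinnedUnitStepEx` (stmt-QuantumFields-27561) — uniqueness and translation invariance of the femto ground state;
# strict Cauchy–Schwarz for a non-constant multiplier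

Seat ym-line-fcl-p3 g9 (2026-08-28).  Helpers for the kinematic stub `stub_smearVarPosGS1 : SmearVarPosGS1` of line «ti-split-1» (planner
ym-idea-1 g6): the stub quantifies over EVERY positive normalised physical pointwise top eigenfunction `Ω′` of the coarse transfer operator
(`∫ K′_{β′}(U′,V′) Ω′(V′) dV′ = λ₀′ Ω′(U′)`); its proof (memo `WINJ-m1-proof-fcl-p3-g9.md` §4 on the item) needs `Ω′` to be
COARSE-TRANSLATION-INVARIANT — which the planner's card derives from Perron–Frobenius simplicity — and ends with the strict Cauchy–Schwarz step
`⟨fΩ,Ω⟩² < ‖fΩ‖²` for a multiplier `f` that is not a.e. constant.  This file lands exactly these two regime-free facts (every `L ≥ 1`, every real `β`):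

* `groundState_unique` — two positive, `l2`-normalised, physical POINTWISE top eigenfunctions of `K_β` are EQUAL (everywhere).  Proof: the tree's
  Jentzsch package `PhysL2.exists_groundState` gives one such `Ω` with a gap `⟨ψ,K_βψ⟩ ≤ θ‖ψ‖²`, `θ < λ₀`, on physical `ψ ⊥ Ω`; for another `Ω′`
  the difference `ψ = Ω′ − ⟨Ω′,Ω⟩Ω ⊥ Ω` is again a `λ₀`-eigenfunction, so `λ₀‖ψ‖² ≤ θ‖ψ‖²` forces `ψ = 0` a.e.; positivity and normalisation give
  `Ω′ = Ω` a.e., and the eigen-equations upgrade a.e. to everywhere.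
* `transferKernel_torusConfigShift`, `transferApply_comp_torusConfigShift`, `groundState_comp_torusConfigShift` — the kernel is translation
  invariant, hence a translate of a ground state is a ground state, hence (uniqueness) **the ground state is translation invariant**;
  `groundState_translationInvariant` restates this with the stub's inline hypotheses (`∀ U, ∫ K Ω = λ₀ Ω U`, shift `U ↦ U(· − v)`).
* `l2_mul_sq_le`, `l2_mul_sq_lt_of_not_ae_const` — for physical `f`, `Ω` with `Ω > 0`, `‖Ω‖ = 1`: `⟨fΩ,Ω⟩² ≤ ‖fΩ‖²`, with STRICT inequality unless
  `f` is a.e. constant (variance identity `‖fΩ‖² − ⟨fΩ,Ω⟩² = ∫(f − m)²Ω²`, `m = ⟨fΩ,Ω⟩`).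
R2b1 is a RECORD rung; nothing here is a summit, a crux or the stub itself.
-/

set_option autoImplicit false

noncomputable section

open MeasureTheory
open Literature.MathematicalPhysics.QuantumFieldTheory (Site Edge GaugeConfig wilsonAction)
open Literature.MathematicalPhysics.QuantumFieldTheory.TorusTranslation
open Literature.MathematicalPhysics.QuantumLattice

namespace Summit.QuantumFields.YangMills.Theorems.FlatTubeReduction.GroundStateUnique

open Summit.QuantumFields.YangMills.Theorems.FemtoTransferGap
open Summit.QuantumFields.YangMills.Theorems.FemtoTransferGap.PhysL2

variable {L : ℕ} [NeZero L]

/-! ## `l2` bookkeeping -/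

/-- `l2` only sees a.e.-classes (left slot). [folklore] -/
theorem l2_congr_ae_left {f g φ : GaugeConfig 3 L SU2 → ℝ} (h : f =ᵐ[configMeasure SU2 L] g) : l2 f φ = l2 g φ := by
  unfold l2
  exact integral_congr_ae (h.mono fun U hU => by simp only [hU])

/-! ## Uniqueness of the positive top eigenfunction -/

/-- **Uniqueness of the femto ground state.**  Two physical, everywhere-positive, `l2`-normalised POINTWISE eigenfunctions of `K_β` for the
top value coincide everywhere. [cite: ReedSimonIV1978, Thm XIII.43 and Thm XIII.44] -/
theorem groundState_unique (β : ℝ) {Ω₁ Ω₂ : GaugeConfig 3 L SU2 → ℝ}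
    (h₁ : IsPhys Ω₁) (hpos₁ : ∀ U, 0 < Ω₁ U) (hn₁ : l2 Ω₁ Ω₁ = 1) (he₁ : transferApply β Ω₁ = topValue su2Rep L β • Ω₁)
    (h₂ : IsPhys Ω₂) (hpos₂ : ∀ U, 0 < Ω₂ U) (hn₂ : l2 Ω₂ Ω₂ = 1) (he₂ : transferApply β Ω₂ = topValue su2Rep L β • Ω₂) :
    Ω₁ = Ω₂ := by
  -- the Jentzsch ground state `Ω` with its gap
  obtain ⟨Ω, θ, c, hΩ, hc, hcle, hn, heig, hθ0, hθ, hgap⟩ := exists_groundState (L := L) β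
  set lam := topValue su2Rep L β with hlam
  have hlam0 : 0 < lam := topValue_su2Rep_pos L β
  -- every competitor equals `Ω`
  have key : ∀ {Ω' : GaugeConfig 3 L SU2 → ℝ}, IsPhys Ω' → (∀ U, 0 < Ω' U) → l2 Ω' Ω' = 1 →
      transferApply β Ω' = lam • Ω' → Ω' = Ω := by
    intro Ω' h' hpos' hn' he'
    set a := l2 Ω' Ω with ha
    set ψ : GaugeConfig 3 L SU2 → ℝ := Ω' + (-a) • Ω with hψdef
    have hψ : IsPhys ψ := h'.add (hΩ.smul (-a))
    have hψΩ : l2 ψ Ω = 0 := by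
      rw [hψdef, l2_add_left h' (hΩ.smul (-a)) hΩ, l2_smul_left, hn, ← ha]; ring
    -- `ψ` is again a `lam`-eigenfunction
    have heψ : transferApply β ψ = lam • ψ := by
      rw [hψdef, transferApply_add β h' (hΩ.smul (-a)), transferApply_smul, he', heig]
      funext U
      simp only [Pi.add_apply, Pi.smul_apply, smul_eq_mul]
      ring
    have hq : qform su2Rep β ψ ψ = lam * l2 ψ ψ := by
      rw [qform_eq_l2_transferApply, heψ, l2_comm, l2_smul_left, l2_comm]
    have hψ0 : l2 ψ ψ = 0 := by
      have h1 : lam * l2 ψ ψ ≤ θ * l2 ψ ψ := hq ▸ hgap ψ hψ hψΩ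
      have h2 : 0 ≤ l2 ψ ψ := l2_self_nonneg ψ
      nlinarith
    have hae : Ω' =ᵐ[configMeasure SU2 L] a • Ω := by
      filter_upwards [PolyakovLift.ae_eq_zero_of_l2_self_eq_zero hψ hψ0] with U hU
      have : Ω' U + -a * Ω U = 0 := by simpa [hψdef] using hU
      rw [Pi.smul_apply, smul_eq_mul]
      linarith
    -- `a = 1`
    have ha2 : a ^ 2 = 1 := by
      have : l2 Ω' Ω' = a ^ 2 := by
        rw [l2_congr_ae_left hae, l2_comm, l2_congr_ae_left hae, l2_smul_left, l2_comm, l2_smul_left, hn]; ring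
      rw [← this, hn']
    obtain ⟨c', hc', hc'le⟩ := exists_pos_le_of_eigen hlam0 h' hpos' he'
    have hapos : 0 < a := l2_pos_of_le h' hΩ hc' hc hc'le hcle
    have ha1 : a = 1 := by nlinarith
    -- a.e. ⇒ everywhere through the eigen-equations
    have hae1 : Ω' =ᵐ[configMeasure SU2 L] Ω := by
      filter_upwards [hae] with U hU
      rw [hU, ha1, one_smul]
    funext U
    have e1 : lam * Ω' U = transferApply β Ω' U := by rw [he', Pi.smul_apply, smul_eq_mul]
    have e2 : lam * Ω U = transferApply β Ω U := by rw [heig, Pi.smul_apply, smul_eq_mul]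
    have e3 : transferApply β Ω' = transferApply β Ω := transferApply_congr_ae hae1
    have : lam * Ω' U = lam * Ω U := by rw [e1, e2, e3]
    exact mul_left_cancel₀ hlam0.ne' this
  rw [key h₁ hpos₁ hn₁ he₁, key h₂ hpos₂ hn₂ he₂]

/-! ## Translation invariance -/

/-- The time-like coupling `Σ_e Re tr ρ(U_e V_e⁻¹)` is invariant under simultaneous translation. [folklore] -/
theorem timeCoupling_torusConfigShift {N : ℕ} {G : Type*} [Group G] [MeasurableSpace G] (ρ : G →* Matrix (Fin N) (Fin N) ℂ)
    (v : Site 3 L) (U V : GaugeConfig 3 L G) :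
    timeCoupling ρ (torusConfigShift v U) (torusConfigShift v V) = timeCoupling ρ U V := by
  simp only [timeCoupling, torusConfigShift_apply]
  exact Fintype.sum_equiv ((Equiv.subRight v).prodCongr (Equiv.refl _)) _ _ fun p => rfl

/-- **The transfer kernel is translation invariant**: `K_β(τ_v U, τ_v V) = K_β(U, V)`. [folklore] -/
theorem transferKernel_torusConfigShift {N : ℕ} {G : Type*} [Group G] [MeasurableSpace G] (ρ : G →* Matrix (Fin N) (Fin N) ℂ)
    (β : ℝ) (v : Site 3 L) (U V : GaugeConfig 3 L G) :
    transferKernel ρ β (torusConfigShift v U) (torusConfigShift v V) = transferKernel ρ β U V := by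
  simp only [transferKernel, timeCoupling_torusConfigShift, Literature.MathematicalPhysics.QuantumFieldTheory.wilsonAction_torusConfigShift]

/-- **`K_β` commutes with translations**: `K_β(Ω ∘ τ_v) = (K_β Ω) ∘ τ_v`. [folklore] -/
theorem transferApply_comp_torusConfigShift (β : ℝ) (v : Site 3 L) (Ω : GaugeConfig 3 L SU2 → ℝ) :
    transferApply β (fun U => Ω (torusConfigShift v U)) = fun U => transferApply β Ω (torusConfigShift v U) := by
  funext U
  rw [transferApply_apply, transferApply_apply]
  have h : ∀ V, transferKernel su2Rep β U V * Ω (torusConfigShift v V) =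
      (fun W => transferKernel su2Rep β (torusConfigShift v U) W * Ω W) (torusConfigShift v V) := fun V => by
    simp only [transferKernel_torusConfigShift]
  simp_rw [h]
  exact integral_comp_torusConfigShift v (fun W => transferKernel su2Rep β (torusConfigShift v U) W * Ω W)

/-- **The ground state is translation invariant**: a positive normalised physical pointwise top eigenfunction satisfies `Ω ∘ τ_v = Ω`.
[cite: ReedSimonIV1978, Thm XIII.43 and Thm XIII.44] -/
theorem groundState_comp_torusConfigShift (β : ℝ) {Ω : GaugeConfig 3 L SU2 → ℝ} (hΩ : IsPhys Ω) (hpos : ∀ U, 0 < Ω U)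
    (hn : l2 Ω Ω = 1) (he : transferApply β Ω = topValue su2Rep L β • Ω) (v : Site 3 L) :
    (fun U => Ω (torusConfigShift v U)) = Ω := by
  refine groundState_unique β (hΩ.comp_torusConfigShift v) (fun U => hpos _) ?_ ?_ hΩ hpos hn he
  · rw [l2_comp_torusConfigShift, hn]
  · rw [transferApply_comp_torusConfigShift, he]
    funext U
    simp only [Pi.smul_apply, smul_eq_mul]

/-- ★ **Translation invariance in the stub's inline form**: with the eigen-equation written as `∀ U, ∫ K_β(U,V) Ω(V) dV = λ₀ Ω(U)` and the
shift as `U ↦ (e ↦ U(e.1 − v, e.2))`, every positive normalised physical solution is invariant. [cite: ReedSimonIV1978, Thm XIII.43 and Thm XIII.44] -/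
theorem groundState_translationInvariant (β : ℝ) {Ω : GaugeConfig 3 L SU2 → ℝ} (hΩ : IsPhys Ω) (hpos : ∀ U, 0 < Ω U)
    (hn : l2 Ω Ω = 1) (he : ∀ U, ∫ V, transferKernel su2Rep β U V * Ω V ∂(configMeasure SU2 L) = topValue su2Rep L β * Ω U)
    (v : Site 3 L) (U : GaugeConfig 3 L SU2) : Ω (fun e => U (e.1 - v, e.2)) = Ω U := by
  have he' : transferApply β Ω = topValue su2Rep L β • Ω := by
    funext W
    rw [transferApply_apply, he W, Pi.smul_apply, smul_eq_mul]
  have h := congrFun (groundState_comp_torusConfigShift β hΩ hpos hn he' v) U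
  have hU : torusConfigShift v U = fun e => U (e.1 - v, e.2) := funext fun e => torusConfigShift_apply v U e
  rw [hU] at h
  exact h

/-! ## Strict Cauchy–Schwarz for a non-constant multiplier -/

/-- Variance identity: `‖fΩ‖² − ⟨fΩ,Ω⟩² = ∫ (f − m)² Ω²` with `m = ⟨fΩ,Ω⟩`, for physical `f`, `Ω` with `‖Ω‖ = 1`. [folklore] -/
theorem l2_mul_sub_sq_eq (f Ω : GaugeConfig 3 L SU2 → ℝ) (hf : IsPhys f) (hΩ : IsPhys Ω) (hn : l2 Ω Ω = 1) :
    l2 (fun U => f U * Ω U) (fun U => f U * Ω U) - l2 (fun U => f U * Ω U) Ω ^ 2 =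
      ∫ U, (f U - l2 (fun U => f U * Ω U) Ω) ^ 2 * Ω U ^ 2 ∂(configMeasure SU2 L) := by
  set m := l2 (fun U => f U * Ω U) Ω with hm
  have hfΩ : IsPhys (fun U => f U * Ω U) := by
    have := hf.mul_of_invariant hΩ.measurable (CJ := Classical.choose hΩ.bounded) (Classical.choose_spec hΩ.bounded)
      hΩ.gaugeInv hΩ.zeroFlux
    simpa [mul_comm] using this
  have i1 : Integrable (fun U => (f U * Ω U) * (f U * Ω U)) (configMeasure SU2 L) := hfΩ.integrable_mul hfΩ
  have i2 : Integrable (fun U => (f U * Ω U) * Ω U) (configMeasure SU2 L) := hfΩ.integrable_mul hΩ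
  have i3 : Integrable (fun U => Ω U * Ω U) (configMeasure SU2 L) := hΩ.integrable_mul hΩ
  have hexp : ∀ U, (f U - m) ^ 2 * Ω U ^ 2 =
      (f U * Ω U) * (f U * Ω U) - 2 * m * ((f U * Ω U) * Ω U) + m ^ 2 * (Ω U * Ω U) := fun U => by ring
  simp_rw [hexp]
  have hsplit : ∫ U, (f U * Ω U * (f U * Ω U) - 2 * m * (f U * Ω U * Ω U) + m ^ 2 * (Ω U * Ω U)) ∂(configMeasure SU2 L) =
      (∫ U, f U * Ω U * (f U * Ω U) ∂(configMeasure SU2 L)) - 2 * m * (∫ U, f U * Ω U * Ω U ∂(configMeasure SU2 L)) +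
        m ^ 2 * ∫ U, Ω U * Ω U ∂(configMeasure SU2 L) := by
    rw [integral_add, integral_sub, integral_const_mul, integral_const_mul]
    · exact i1
    · exact i2.const_mul _
    · exact i1.sub (i2.const_mul _)
    · exact i3.const_mul _
  rw [hsplit]
  unfold l2 at hn hm ⊢
  rw [hn, ← hm]
  ring

/-- `⟨fΩ,Ω⟩² ≤ ‖fΩ‖²` (`‖Ω‖ = 1`). [folklore] -/
theorem l2_mul_sq_le (f Ω : GaugeConfig 3 L SU2 → ℝ) (hf : IsPhys f) (hΩ : IsPhys Ω) (hn : l2 Ω Ω = 1) :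
    l2 (fun U => f U * Ω U) Ω ^ 2 ≤ l2 (fun U => f U * Ω U) (fun U => f U * Ω U) := by
  have h := l2_mul_sub_sq_eq f Ω hf hΩ hn
  have hnn : 0 ≤ ∫ U, (f U - l2 (fun U => f U * Ω U) Ω) ^ 2 * Ω U ^ 2 ∂(configMeasure SU2 L) :=
    integral_nonneg fun U => mul_nonneg (sq_nonneg _) (sq_nonneg _)
  linarith

/-- ★ **Strict Cauchy–Schwarz**: if `Ω > 0` everywhere, `‖Ω‖ = 1`, and the physical multiplier `f` is NOT a.e. constant, then
`⟨fΩ,Ω⟩² < ‖fΩ‖²` (the conclusion of `SmearVarPosGS1` for `f = fbar`). [folklore] -/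
theorem l2_mul_sq_lt_of_not_ae_const (f Ω : GaugeConfig 3 L SU2 → ℝ) (hf : IsPhys f) (hΩ : IsPhys Ω) (hpos : ∀ U, 0 < Ω U)
    (hn : l2 Ω Ω = 1) (hne : ∀ c : ℝ, ¬ (f =ᵐ[configMeasure SU2 L] fun _ => c)) :
    l2 (fun U => f U * Ω U) Ω ^ 2 < l2 (fun U => f U * Ω U) (fun U => f U * Ω U) := by
  set m := l2 (fun U => f U * Ω U) Ω with hm
  refine lt_of_le_of_ne (l2_mul_sq_le f Ω hf hΩ hn) fun heq => hne m ?_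
  have h := l2_mul_sub_sq_eq f Ω hf hΩ hn
  rw [← hm] at h
  have h0 : ∫ U, (f U - m) ^ 2 * Ω U ^ 2 ∂(configMeasure SU2 L) = 0 := by linarith
  have hint : Integrable (fun U => (f U - m) ^ 2 * Ω U ^ 2) (configMeasure SU2 L) := by
    have hφ : IsPhys (fun U => f U - m) := by
      have h1 := hf.add (isPhys_const (G := SU2) (L := L) (-m))
      have h2 : (f + fun _ : GaugeConfig 3 L SU2 => -m) = fun U => f U - m := by
        funext U; simp [sub_eq_add_neg]
      rw [h2] at h1
      exact h1
    obtain ⟨C, hC⟩ := hΩ.bounded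
    obtain ⟨D, hD⟩ := hφ.bounded
    refine Integrable.mono' (integrable_const (D ^ 2 * C ^ 2))
      (((hf.measurable.sub measurable_const).pow_const 2).mul (hΩ.measurable.pow_const 2)).aestronglyMeasurable
      (ae_of_all _ fun U => ?_)
    rw [Real.norm_eq_abs, abs_mul, abs_pow, abs_pow]
    have h1 : |f U - m| ^ 2 ≤ D ^ 2 := pow_le_pow_left₀ (abs_nonneg _) (hD U) 2
    have h2 : |Ω U| ^ 2 ≤ C ^ 2 := pow_le_pow_left₀ (abs_nonneg _) (hC U) 2
    exact mul_le_mul h1 h2 (pow_nonneg (abs_nonneg _) 2) (sq_nonneg _)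
  have hz := (integral_eq_zero_iff_of_nonneg (fun U => mul_nonneg (sq_nonneg _) (sq_nonneg _)) hint).1 h0
  filter_upwards [hz] with U hU
  have hU' : (f U - m) ^ 2 * Ω U ^ 2 = 0 := hU
  rcases mul_eq_zero.1 hU' with h1 | h1
  · exact sub_eq_zero.1 (pow_eq_zero_iff two_ne_zero |>.1 h1)
  · exact absurd (pow_eq_zero_iff two_ne_zero |>.1 h1) (hpos U).ne'

end Summit.QuantumFields.YangMills.Theorems.FlatTubeReduction.GroundStateUnique
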